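/-
Copyright (c) 2026 the pub-hodgecm-mathlib formalisation cell (harness21).  Prover seat hodgecm-mathlib-K2Liu-p12 (g6), Track B «K2-LIT»,
#184♮ = hLiu418 = `stmt-HodgeConjecture-24832`; #42S block D, row D-2, (σ-A) mini-road, brick (an-3c-charts) — RECORD WRAPPER.
THEOREMS ONLY (no `def`, no `instance`, no `notation`, no named-fact hypothesis, no `sorry`).
-/
import Summits.HodgeConjecture.HodgeConjecture.Theorems.K2LiuQuadraticCoordinateMultiplication   -- ★ p864628 FILE 1 (the anisotropy letters at `K_v`)
import Summits.HodgeConjecture.HodgeConjecture.Theorems.K2LiuConeChartFrames                     -- ★ p864769 FILE 2 (`zm_lowerBound`, generic `F`)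
import HarnessLib

/-!
# Crux `HLiu418`, #42S block D row D-2, (σ-A) brick (an-3c-charts) RECORD WRAPPER `K2LiuConeLowerBoundRecord`:
# `hZlow` AT `F := K_v` WITH NO LETTER BY VALUE — FILE 2's `zm_lowerBound` ∘ FILE 1's `mem_primePowBall_of_mul_mem`

Cell `hodgecm-mathlib`, crux item hLiu418 = `stmt-HodgeConjecture-24832`; lane `--supports stmt-HodgeConjecture-24832 --as helper` (count-neutral helper).

WHAT.  ★ p864769 `K2LiuConeChartFrames.zm_lowerBound` delivers (I1)∕(I2)'s letter `hZlow` over ANY local field `F` from the arithmetic letter `hlow` BY VALUE;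
★ p864628 `K2LiuQuadraticCoordinateMultiplication.mem_primePowBall_of_mul_mem` IS that letter at `F := K_v = v.adicCompletion K` (`K` a number field, `v` finite,
`d ∈ K_v` not a square), with constants `c₄`, `c_d` read off `|4|_v`, `|d|_v`.  THIS FILE composes the two once, so that K2Liu-p08's END instantiation
((an-3c) §3b (D) `hcone_hZ_of_record`) takes `hZlow` BY NAME with an ∃-bound constant and no arithmetic side-letter:
**`exists_zm_lowerBound_adicCompletion`**: `∃ c₀ : ℤ, ∀ s ≠ 0, ∀ N ζ, Zm s ζ ∈ (𝔭^N)^{ι₁} → ζ ∈ (𝔭^{N − level s − c₀})²` (`c₀ = c₄ + 2|c_d|`).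
[cite: WeilBNT1967, Chap. II §2, Def. 2] [cite: Omeara1963, §63B (63:1)–(63:3)]
HONEST LABEL.  Count-neutral helper; it retires nothing by itself: `HC_CM` is proved only modulo the 7 printed citations (2 remaining named inputs:
hLiu418 = `stmt-HodgeConjecture-24832`, h413 = `stmt-HodgeConjecture-24833`) until rung 0 closes.

## References
* [WeilBNT1967] A. Weil, *Basic Number Theory* (1967), Chap. II §2 Def. 2 (boxes and levels).
* [Omeara1963] O. T. O'Meara, *Introduction to Quadratic Forms* (1963), §63B.
-/

set_option autoImplicit false
set_option linter.dupNamespace false -- the mandated namespace repeats `HodgeConjecture.HodgeConjecture`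

open Matrix
open scoped NNReal
open NumberField IsDedekindDomain
open Literature.NumberTheory.Automorphic
open Literature.NumberTheory.GaloisRepresentations Literature.NumberTheory.GaloisRepresentations.IsNonarchimedeanLocalField
open Literature.NumberTheory.Weil1965.SplitPlace (level)
open Summit.HodgeConjecture.HodgeConjecture.Cruxes.HLiu418

namespace Summit.HodgeConjecture.HodgeConjecture.Cruxes.HLiu418.K2LiuConeLowerBoundRecord

/-- **`hZlow` AT THE RECORD, NO LETTER BY VALUE**: for `K` a number field, `v` a finite place, `d ∈ K_v` NOT a square, quadratic-coordinate slots `eJ, eJ′`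
and the multiplication graph `Zm` (`hZm`), there is `c₀ : ℤ` with `∀ s ≠ 0, ∀ N ζ, Zm s ζ ∈ (𝔭^N)^{ι₁} → ζ ∈ (𝔭^{N − level s − c₀})²` — ★ p864769
`zm_lowerBound` at `hlow :=` ★ p864628 `mem_primePowBall_of_mul_mem K v hd h4 hdv`, `c₀ := c₄ + 2|c_d|`.
[cite: WeilBNT1967, Chap. II §2, Def. 2] [cite: Omeara1963, §63B (63:1)–(63:3)] -/
theorem exists_zm_lowerBound_adicCompletion (K : Type) [Field K] [NumberField K] (v : HeightOneSpectrum (𝓞 K))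
    {n : ℕ} {ι₁ ι₁' : Type*} [Fintype ι₁'] [Nonempty ι₁'] (eJ : Fin n × Fin 2 ≃ ι₁) (eJ' : Fin n × Fin 2 ≃ ι₁')
    {d : v.adicCompletion K} (hd : ¬ IsSquare d)
    (Zm : (ι₁' → v.adicCompletion K) → ((Fin 2 → v.adicCompletion K) →ₗ[v.adicCompletion K] (ι₁ → v.adicCompletion K)))
    (hZm : ∀ (s : ι₁' → v.adicCompletion K) (ζ : Fin 2 → v.adicCompletion K) (j : Fin n),
      Zm s ζ (eJ (j, 0)) = ζ 0 * s (eJ' (j, 0)) + d * ζ 1 * s (eJ' (j, 1)) ∧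
      Zm s ζ (eJ (j, 1)) = ζ 0 * s (eJ' (j, 1)) + ζ 1 * s (eJ' (j, 0))) :
    ∃ c₀ : ℤ, ∀ s : ι₁' → v.adicCompletion K, s ≠ 0 → ∀ (N : ℤ) (ζ : Fin 2 → v.adicCompletion K),
      Zm s ζ ∈ piPrimePowBall (v.adicCompletion K) ι₁ N → ζ ∈ piPrimePowBall (v.adicCompletion K) (Fin 2) (N - level s - c₀) := by
  obtain ⟨c₄, -, h4⟩ := K2LiuQuadraticCoordinateMultiplication.exists_normAbs_four_eq K v
  obtain ⟨cd, hdv⟩ := K2LiuQuadraticCoordinateMultiplication.exists_normAbs_eq_of_not_isSquare K v hd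
  exact ⟨c₄ + 2 * |cd|, fun s hs N ζ hζ => K2LiuConeChartFrames.zm_lowerBound eJ eJ' d Zm hZm (c₄ + 2 * |cd|)
    (fun α β x y Kx ℓ hxy h1 h2 => K2LiuQuadraticCoordinateMultiplication.mem_primePowBall_of_mul_mem K v hd h4 hdv hxy h1 h2) s hs N ζ hζ⟩

end Summit.HodgeConjecture.HodgeConjecture.Cruxes.HLiu418.K2LiuConeLowerBoundRecord
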